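import Mathlib
import HarnessLib

/-!
# The one-block dichotomy for a finite `3`-elementary group with an automorphism of order `3`
# (cell `b2b-bsdres`, CLASS-CLOSURE instrument seat cc-eng-4, GEN 16; zero kit; TOOL theorems)

HONEST FRAMING (cell `b2b-bsdres`, run/shared/lean/b2b/bsd-rank1-residual/, verbatim in every
file): the goal of the cell is to DELETE the COMBINATION-SHAPED residual classes of the
Birch–Swinnerton-Dyer formula for ALL analytic-rank `≤ 1` elliptic curves over `ℚ` — "full BSD
formula for every rank `≤ 1` curve in class `C`" assembled STRICTLY from published theorems — so
that the rank-`≤ 1` remainder becomes exactly the CONSTRUCTION-SHAPED classes, which are TYPED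
(missing-input `Prop`s), NOT attempted. This is not "finishing BSD". Pure finite-group TOOL
theorems; NOT class theorems; nothing here is booked; no record is filed in this file.
THEOREMS ONLY (no definition, no named fact, no `sorry`).

## What this file does (and why an instrument seat files it)

The instrument want `I-O6-SHA-K1` (class O6, census test C-O6-G16-EQ: the `3`-Selmer rank of
`W` over the cubic field `k₁ = ℚ(ζ₉)⁺`) is answered in the seat's feasibility note
`class-closure/eng-4/FEASIBILITY-I-O6-SHA-K1.md` by a ℚ-SIDE FIXED-PART reading: for
`G = Gal(k₁/ℚ) = ⟨σ⟩ ≅ ℤ/3`, the Selmer group `M = Sel₃(W/k₁)` is a finite group of exponent `3`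
on which `σ` acts with `σ³ = 1`; the FIXED PART `M^σ` is a modified `3`-Selmer group of `W/ℚ`
whose order a ℚ-descent plus ONE local norm-index bit `δ₃` at the prime over `3` determines
(`#M^σ = 3^{δ₃}`, `δ₃ ≤ 1`, when `Sel₃(W/ℚ) = 0`), and the PARITY TRANSFER makes
`dim_𝔽₃ M` even.  The last step of that reading is pure finite-group algebra and is what this
file kernel-checks:

* `natCard_le_natCard_fixed_pow_three` — for ANY finite additive group `V` killed by `3` and any
  endomorphism `σ` with `σ ∘ σ ∘ σ = id`, `#V ≤ (#V^σ)³` (the nilpotent operator `σ − 1` has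
  cube zero, so `V` is filtered by three pieces each no bigger than its kernel `V^σ`);
* `natCard_eq_one_of_natCard_fixed_eq_one` — hence `V^σ = 0 ⇒ V = 0` (the `3`-group
  fixed-point lemma, here with an explicit bound: "`M ≠ 0 ⟺ M^G ≠ 0`");
* `natCard_eq_one_or_eq_nine_of_fixed_le_three` — if `#V^σ ≤ 3` and `#V = 3^k` with `k`
  EVEN then `#V ∈ {1, 9}` (one Jordan block of even length inside `𝔽₃[x]/(x³)`);
* `natCard_eq_nine_of_fixed_eq_three` — if moreover `#V^σ = 3` then `#V = 9`:
  the shape `dim_𝔽₃ Sel₃(W/k₁) = 2·δ₃` of the note, with `#V^σ = 3^{δ₃}` and the parity as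
  BINDERS (they are Galois-cohomological inputs — Brau 2014 Prop. 5.2 after Mazur–Rubin 2007,
  and Cassels — that the tree does not derive here).

No elliptic curve, Selmer group or number field appears: the consumer instantiates `V` with the
finite group underlying `Sel₃(W/k₁)` and `σ` with the action of a generator of `Gal(k₁/ℚ)`.
-/

namespace Summit.BirchSwinnertonDyer.Rank1Residual.SecondDescent

variable {V : Type*} [AddCommGroup V]

/-- For an endomorphism `σ` of an additive group killed by `3` with `σ (σ (σ v)) = v`, the operator
`σ - id` has cube zero: `(σ - 1)³ = σ³ - 3σ² + 3σ - 1 = 0`. -/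
theorem sub_id_apply_sub_id_apply_sub_id_apply_eq_zero (h3 : ∀ v : V, 3 • v = 0) (σ : V →+ V)
    (hσ : ∀ v, σ (σ (σ v)) = v) (v : V) :
    (σ - AddMonoidHom.id V) ((σ - AddMonoidHom.id V) ((σ - AddMonoidHom.id V) v)) = 0 := by
  simp only [AddMonoidHom.sub_apply, AddMonoidHom.id_apply, map_sub, hσ]
  calc v - σ (σ v) - (σ (σ v) - σ v) - (σ (σ v) - σ v - (σ v - v))
        = 3 • σ v - 3 • σ (σ v) := by abel
    _ = 0 := by rw [h3, h3, sub_zero]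

/-- The fixed points of `σ` are exactly the kernel of `σ - id`. -/
theorem mem_ker_sub_id_iff (σ : V →+ V) (v : V) :
    v ∈ (σ - AddMonoidHom.id V).ker ↔ σ v = v := by
  rw [AddMonoidHom.mem_ker, AddMonoidHom.sub_apply, AddMonoidHom.id_apply, sub_eq_zero]

/-- `#{v // σ v = v} = #ker(σ - id)`. -/
theorem natCard_fixed_eq_natCard_ker (σ : V →+ V) :
    Nat.card {v : V // σ v = v} = Nat.card (σ - AddMonoidHom.id V).ker := by
  refine Nat.card_congr ?_
  exact
    { toFun := fun x => ⟨x.1, (mem_ker_sub_id_iff σ x.1).2 x.2⟩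
      invFun := fun x => ⟨x.1, (mem_ker_sub_id_iff σ x.1).1 x.2⟩
      left_inv := fun x => rfl
      right_inv := fun x => rfl }

/-- Core counting step.  If an endomorphism `g` of a finite additive group satisfies
`g (g (g v)) = 0` for all `v`, then `#V ≤ (#ker g)³`: indeed `#V = #ker g · #g(V)`,
`#g(V) = #(ker g ∩ g(V)) · #g(g(V)) ≤ #ker g · #g(g(V))`, and `g(g(V)) ⊆ ker g`. -/
theorem natCard_le_natCard_ker_pow_three_of_comp_three_eq_zero [Finite V] (g : V →+ V)
    (hg : ∀ v, g (g (g v)) = 0) : Nat.card V ≤ Nat.card g.ker ^ 3 := by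
  classical
  -- rank–nullity for `g`
  have hV : Nat.card V = Nat.card g.range * Nat.card g.ker := by
    rw [AddSubgroup.card_eq_card_quotient_mul_card_addSubgroup g.ker,
      Nat.card_congr (QuotientAddGroup.quotientKerEquivRange g).toEquiv]
  -- `g` restricted to its range
  set g₁ : g.range →+ V := g.comp g.range.subtype with hg₁
  have hR : Nat.card g.range = Nat.card g₁.range * Nat.card g₁.ker := by
    rw [AddSubgroup.card_eq_card_quotient_mul_card_addSubgroup g₁.ker,
      Nat.card_congr (QuotientAddGroup.quotientKerEquivRange g₁).toEquiv]
  -- `ker g₁ ↪ ker g`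
  have hker : Nat.card g₁.ker ≤ Nat.card g.ker := by
    refine Nat.card_le_card_of_injective
      (fun x : g₁.ker => (⟨x.1.1, ?_⟩ : g.ker)) ?_
    · have hx := x.2
      rw [AddMonoidHom.mem_ker] at hx ⊢
      simpa [hg₁] using hx
    · intro x y hxy
      apply Subtype.ext
      apply Subtype.ext
      exact congrArg (fun z : g.ker => (z : V)) hxy
  -- `range g₁ = g(g(V)) ↪ ker g`
  have hran : Nat.card g₁.range ≤ Nat.card g.ker := by
    refine Nat.card_le_card_of_injective
      (fun y : g₁.range => (⟨y.1, ?_⟩ : g.ker)) ?_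
    · obtain ⟨⟨r, hr⟩, hy⟩ := y.2
      obtain ⟨v, hv⟩ := hr
      rw [AddMonoidHom.mem_ker, ← hy, hg₁, AddMonoidHom.comp_apply, AddSubgroup.subtype_apply]
      change g (g r) = 0
      rw [← hv]
      exact hg v
    · intro x y hxy
      apply Subtype.ext
      exact congrArg (fun z : g.ker => (z : V)) hxy
  calc Nat.card V = Nat.card g₁.range * Nat.card g₁.ker * Nat.card g.ker := by rw [hV, hR]
    _ ≤ Nat.card g.ker * Nat.card g.ker * Nat.card g.ker := by gcongr
    _ = Nat.card g.ker ^ 3 := by ring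

/-- **`#V ≤ (#V^σ)³`.**  For a finite additive group `V` killed by `3` and an endomorphism `σ`
with `σ ∘ σ ∘ σ = id` (the action of a generator of a cyclic group of order `3`, e.g.
`Gal(ℚ(ζ₉)⁺/ℚ)` on `Sel₃(W/ℚ(ζ₉)⁺)`), the whole group is at most the cube of its fixed part:
`V` is an `𝔽₃[x]/(x³)`-module (`x = σ - 1`), a sum of Jordan blocks of length `≤ 3`, and the
number of blocks is `dim V^σ`. -/
theorem natCard_le_natCard_fixed_pow_three [Finite V] (h3 : ∀ v : V, 3 • v = 0) (σ : V →+ V)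
    (hσ : ∀ v, σ (σ (σ v)) = v) : Nat.card V ≤ Nat.card {v : V // σ v = v} ^ 3 := by
  rw [natCard_fixed_eq_natCard_ker σ]
  exact natCard_le_natCard_ker_pow_three_of_comp_three_eq_zero (σ - AddMonoidHom.id V)
    (sub_id_apply_sub_id_apply_sub_id_apply_eq_zero h3 σ hσ)

/-- The fixed part is never bigger than the group. -/
theorem natCard_fixed_le_natCard [Finite V] (σ : V →+ V) :
    Nat.card {v : V // σ v = v} ≤ Nat.card V :=
  Nat.card_le_card_of_injective (fun x : {v : V // σ v = v} => (x : V)) Subtype.val_injective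

/-- **Fixed-point lemma with a bound** ("`M ≠ 0 ⟺ M^G ≠ 0`" for a `3`-elementary `ℤ/3`-module):
if `σ` (with `σ³ = id`, `3V = 0`) fixes only `0`, then `V = 0`. -/
theorem natCard_eq_one_of_natCard_fixed_eq_one [Finite V] (h3 : ∀ v : V, 3 • v = 0)
    (σ : V →+ V) (hσ : ∀ v, σ (σ (σ v)) = v) (hfix : Nat.card {v : V // σ v = v} = 1) :
    Nat.card V = 1 := by
  have h := natCard_le_natCard_fixed_pow_three h3 σ hσ
  rw [hfix, one_pow] at h
  have hpos : 0 < Nat.card V := Nat.card_pos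
  omega

/-- Conversely a non-trivial `V` has a non-zero fixed vector: `#V^σ ≠ 1` as soon as `#V ≠ 1`. -/
theorem one_lt_natCard_fixed_of_one_lt_natCard [Finite V] (h3 : ∀ v : V, 3 • v = 0)
    (σ : V →+ V) (hσ : ∀ v, σ (σ (σ v)) = v) (hV : 1 < Nat.card V) :
    1 < Nat.card {v : V // σ v = v} := by
  by_contra hle
  haveI : Nonempty {v : V // σ v = v} := ⟨⟨0, map_zero σ⟩⟩
  have hpos : 0 < Nat.card {v : V // σ v = v} := Nat.card_pos
  have hfix : Nat.card {v : V // σ v = v} = 1 := by omega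
  have := natCard_eq_one_of_natCard_fixed_eq_one h3 σ hσ hfix
  omega

/-- **The one-block dichotomy.**  If the fixed part has at most `3` elements (at most ONE Jordan
block) and `#V = 3^k` with `k` even (the parity transfer
`dim_𝔽₃ Sel₃(W/k₁) ≡ dim_𝔽₃ Sel₃(W/ℚ) (mod 2)` with `Sel₃(W/ℚ) = 0`), then `#V = 1` or
`#V = 9`: a single block of even length inside `𝔽₃[x]/(x³)` has length `0` or `2`. -/
theorem natCard_eq_one_or_eq_nine_of_fixed_le_three [Finite V] (h3 : ∀ v : V, 3 • v = 0)
    (σ : V →+ V) (hσ : ∀ v, σ (σ (σ v)) = v) (hfix : Nat.card {v : V // σ v = v} ≤ 3)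
    {k : ℕ} (hk : Nat.card V = 3 ^ k) (heven : Even k) :
    Nat.card V = 1 ∨ Nat.card V = 9 := by
  have h := natCard_le_natCard_fixed_pow_three h3 σ hσ
  have h27 : Nat.card V ≤ 3 ^ 3 :=
    h.trans (Nat.pow_le_pow_left hfix 3)
  rw [hk] at h27
  have hk3 : k ≤ 3 := (Nat.pow_le_pow_iff_right (by norm_num : 1 < 3)).1 h27
  obtain ⟨m, rfl⟩ := heven
  have hm : m ≤ 1 := by omega
  interval_cases m
  · left; simpa using hk
  · right; simpa using hk

/-- **The `δ₃ = 1` shape: `dim_𝔽₃ Sel₃(W/k₁) = 2`.**  If the fixed part has EXACTLY `3`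
elements (`#Sel₃(W/k₁)^G = 3^{δ₃}` with `δ₃ = 1` — Brau's count with the local norm-index bit at
the prime over `3` equal to `1`) and `#V = 3^k` with `k` even, then `#V = 9`. -/
theorem natCard_eq_nine_of_fixed_eq_three [Finite V] (h3 : ∀ v : V, 3 • v = 0) (σ : V →+ V)
    (hσ : ∀ v, σ (σ (σ v)) = v) (hfix : Nat.card {v : V // σ v = v} = 3) {k : ℕ}
    (hk : Nat.card V = 3 ^ k) (heven : Even k) : Nat.card V = 9 := by
  have hle : Nat.card {v : V // σ v = v} ≤ Nat.card V := natCard_fixed_le_natCard σ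
  rcases natCard_eq_one_or_eq_nine_of_fixed_le_three h3 σ hσ hfix.le hk heven with h1 | h9
  · omega
  · exact h9

/-- **The `δ₃ = 0` shape: `Sel₃(W/k₁) = 0`.**  If the fixed part is trivial (`δ₃ = 0`) then the
whole group is trivial — no parity input needed. -/
theorem natCard_eq_one_of_fixed_eq_one' [Finite V] (h3 : ∀ v : V, 3 • v = 0) (σ : V →+ V)
    (hσ : ∀ v, σ (σ (σ v)) = v) (hfix : Nat.card {v : V // σ v = v} = 3 ^ 0) :
    Nat.card V = 3 ^ 0 := by
  rw [pow_zero] at hfix ⊢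
  exact natCard_eq_one_of_natCard_fixed_eq_one h3 σ hσ hfix

/-- Uniform statement of the two shapes: with `#V^σ = 3^δ`, `δ ≤ 1`, `#V = 3^k`, `k` even,
one has `#V = 3^(2δ)` — i.e. `dim_𝔽₃ V = 2δ`. -/
theorem natCard_eq_three_pow_two_mul_of_fixed_eq_three_pow [Finite V] (h3 : ∀ v : V, 3 • v = 0)
    (σ : V →+ V) (hσ : ∀ v, σ (σ (σ v)) = v) {δ : ℕ} (hδ : δ ≤ 1)
    (hfix : Nat.card {v : V // σ v = v} = 3 ^ δ) {k : ℕ} (hk : Nat.card V = 3 ^ k)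
    (heven : Even k) : Nat.card V = 3 ^ (2 * δ) := by
  interval_cases δ
  · simpa using natCard_eq_one_of_fixed_eq_one' h3 σ hσ hfix
  · have h9 := natCard_eq_nine_of_fixed_eq_three h3 σ hσ (by simpa using hfix) hk heven
    simpa using h9

end Summit.BirchSwinnertonDyer.Rank1Residual.SecondDescent
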